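import Literature.Barriers.Parity.SmallScalePatterns
import Mathlib.RingTheory.PrincipalIdealDomain
import Mathlib.Algebra.Field.ZMod
import Mathlib.GroupTheory.Index
import HarnessLib

/-!
# Small-scale irregularity of linear patterns of primes: systems of a single form

Proof companion (part 1 of 3) of `Literature/Barriers/Parity/SmallScalePatterns.lean`
(Pandey–Woo 2024, Theorem 5, the named fact `SmallScalePatternIrregularity`). The three companion
files PROVE the case `t = 1` of the fact (one linear form `ψ(n) = ∑ⱼ cⱼ nⱼ`, `cⱼ ≥ 0`, `c ≠ 0`, in
any dimension `d ≥ 1`), which contains the case `d = 1` (= Maier's theorem for all `λ > 1`, the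
paper's Theorem 1, in the box form of Theorem 5); everything here is PROVED.

This file: the arithmetic of a single form.

* `SingleForm.card_filter_dvd_eval` — for a prime `p` not dividing all `cⱼ`,
  `#{n ∈ (ℤ/p)^d : p ∣ ψ(n)} = p^{d-1}` (kernel of a surjective homomorphism `(ℤ/p)^d → ℤ/p`);
  hence `localFactor_eq_one` : `β_p = 1`, and `localFactor_eq_zero` : `β_p = 0` when `p ∣ cⱼ`
  for all `j` [cite: PandeyWoo2024, Theorem 3 (definition of `β_p`)];
* `SingleForm.singularProduct_eq_one` / `singularProduct_eq_zero` — `∏_p β_p = 1` for a primitive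
  form, `= 0` when some prime divides every coefficient;
* `SingleForm.bezout_or_prime_dvd` — either `∑ⱼ cⱼ vⱼ = 1` for some `v ∈ ℤ^d` or some prime
  divides every `cⱼ` (`ℤ` is a principal ideal ring);
* `SingleForm.card_box_filter_eq` — lattice points of `∏ⱼ [zⱼ, zⱼ + H]` are `z + [0, H]^d`
  (translation), and `primePatternCount_fin_one`.

## References

* M. Pandey, K. Woo, *Small scale distribution of linear patterns of primes*, J. London Math.
  Soc. 110 (2024) e13001, arXiv:2304.14267: Theorem 1 (Maier), Theorem 3 (`β_p`), Theorem 5.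
* B. Green, T. Tao, *Linear equations in primes*, Ann. of Math. 171 (2010), (1.6) (`β_p`).
-/

noncomputable section

open Filter Finset Topology

namespace Literature.Barriers.Parity

open Literature.NumberTheory.Sieve

namespace SingleForm

variable {d : ℕ}

/-! ## Linear forms with zero constant term -/

/-- `ψ(n) = ∑ⱼ cⱼ nⱼ` when `ψ(0) = 0`. [cite: GreenTao2010, Def. 1.1] -/
theorem eval_eq_sum (ψ : AffLinForm d) (h0 : ψ.const = 0) (n : Fin d → ℤ) :
    ψ.eval n = ∑ j, ψ.coeff j * n j := by
  simp [AffLinForm.eval, h0]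

/-- Additivity of a linear form. [folklore] -/
theorem eval_add (ψ : AffLinForm d) (h0 : ψ.const = 0) (n n' : Fin d → ℤ) :
    ψ.eval (n + n') = ψ.eval n + ψ.eval n' := by
  simp only [eval_eq_sum ψ h0, Pi.add_apply, mul_add, sum_add_distrib]

/-- The value of a linear form at the point `q·𝟙 + s·v` of the line through `q·𝟙` in a
direction `v` with `ψ(v) = 1`: `ψ(q𝟙 + s v) = (∑ⱼ cⱼ) q + s`. [folklore] -/
theorem eval_line (ψ : AffLinForm d) (h0 : ψ.const = 0) {v : Fin d → ℤ} (hv : ψ.eval v = 1)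
    (q s : ℤ) : ψ.eval (fun j => q + s * v j) = (∑ j, ψ.coeff j) * q + s := by
  have hv' : ∑ j, ψ.coeff j * v j = 1 := by rwa [eval_eq_sum ψ h0] at hv
  rw [eval_eq_sum ψ h0]
  calc ∑ j, ψ.coeff j * (q + s * v j) = ∑ j, (ψ.coeff j * q + s * (ψ.coeff j * v j)) :=
        sum_congr rfl fun j _ => by ring
    _ = (∑ j, ψ.coeff j) * q + s * ∑ j, ψ.coeff j * v j := by
        rw [sum_add_distrib, sum_mul, mul_sum]
    _ = (∑ j, ψ.coeff j) * q + s := by rw [hv', mul_one]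

/-- A form with non-negative coefficients is non-negative on the positive orthant. [folklore] -/
theorem eval_nonneg (ψ : AffLinForm d) (h0 : ψ.const = 0) (hc : ∀ j, 0 ≤ ψ.coeff j)
    {n : Fin d → ℤ} (hn : ∀ j, 0 ≤ n j) : 0 ≤ ψ.eval n := by
  rw [eval_eq_sum ψ h0]
  exact sum_nonneg fun j _ => mul_nonneg (hc j) (hn j)

/-- `ψ(n) ≤ (∑ⱼ cⱼ) B` on `[0, B]^d` for non-negative coefficients. [folklore] -/
theorem eval_le (ψ : AffLinForm d) (h0 : ψ.const = 0) (hc : ∀ j, 0 ≤ ψ.coeff j)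
    {n : Fin d → ℤ} {B : ℤ} (hn : ∀ j, n j ≤ B) :
    ψ.eval n ≤ (∑ j, ψ.coeff j) * B := by
  rw [eval_eq_sum ψ h0, sum_mul]
  exact sum_le_sum fun j _ => mul_le_mul_of_nonneg_left (hn j) (hc j)

/-- One term is at most the whole (non-negative) sum: `cⱼ nⱼ ≤ ψ(n)` on the positive orthant.
[folklore] -/
theorem coeff_mul_le_eval (ψ : AffLinForm d) (h0 : ψ.const = 0) (hc : ∀ j, 0 ≤ ψ.coeff j)
    {n : Fin d → ℤ} (hn : ∀ j, 0 ≤ n j) (j : Fin d) : ψ.coeff j * n j ≤ ψ.eval n := by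
  rw [eval_eq_sum ψ h0]
  exact single_le_sum (f := fun j => ψ.coeff j * n j) (fun i _ => mul_nonneg (hc i) (hn i))
    (mem_univ j)

/-- The sum of the coefficients is `ψ(𝟙)`; it is `≥ 1` for a non-zero form with non-negative
coefficients. [folklore] -/
theorem one_le_sum_coeff (ψ : AffLinForm d) (hc : ∀ j, 0 ≤ ψ.coeff j) (hne : ψ.coeff ≠ 0) :
    1 ≤ ∑ j, ψ.coeff j := by
  obtain ⟨j, hj⟩ : ∃ j, ψ.coeff j ≠ 0 := by
    by_contra h
    push Not at h
    exact hne (funext h)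
  have hj1 : 1 ≤ ψ.coeff j := by have := hc j; omega
  exact le_trans hj1 (single_le_sum (f := ψ.coeff) (fun i _ => hc i) (mem_univ j))

/-! ## Local factors of a single form -/

/-- `Λ_{ℤ/p}(b)` for a prime `p`: `0` if `p ∣ b`, `p/(p-1)` otherwise. [cite: GreenTao2010, (1.5)] -/
theorem localVonMangoldt_prime {p : ℕ} (hp : p.Prime) (b : ℤ) :
    localVonMangoldt p b = if (p : ℤ) ∣ b then 0 else (p : ℝ) / ((p : ℝ) - 1) := by
  unfold localVonMangoldt
  have key : Int.gcd b p = 1 ↔ ¬ (p : ℤ) ∣ b := by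
    have h1 : Int.gcd b p = Nat.gcd b.natAbs p := by rw [Int.gcd, Int.natAbs_natCast]
    rw [h1, ← Nat.coprime_iff_gcd_eq_one, Nat.coprime_comm, hp.coprime_iff_not_dvd,
      Int.natCast_dvd]
  have htot : (Nat.totient p : ℝ) = (p : ℝ) - 1 := by
    rw [Nat.totient_prime hp, Nat.cast_sub hp.one_le, Nat.cast_one]
  by_cases h : (p : ℤ) ∣ b
  · rw [if_neg (fun h1 => (key.1 h1) h), if_pos h]
  · rw [if_pos (key.2 h), if_neg h, htot]

/-- **Fibres of a linear form mod `p`.** If `p` is prime and does not divide every coefficient of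
the linear form `ψ` (`ψ(0) = 0`), then exactly `p^{d-1}` of the `p^d` points `n ∈ {0,…,p-1}^d`
have `p ∣ ψ(n)` (the kernel of the surjective homomorphism `n ↦ ψ(n) mod p` on `(ℤ/p)^d`).
[folklore] -/
theorem card_filter_dvd_eval {p : ℕ} (hp : p.Prime) (ψ : AffLinForm d) (h0 : ψ.const = 0)
    (hj : ∃ j, ¬ (p : ℤ) ∣ ψ.coeff j) :
    #{n ∈ Fintype.piFinset (fun _ : Fin d => range p) | (p : ℤ) ∣ ψ.eval fun j => (n j : ℤ)} =
      p ^ (d - 1) := by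
  classical
  haveI := Fact.mk hp
  obtain ⟨j₀, hj₀⟩ := hj
  have hd : 1 ≤ d := Nat.one_le_iff_ne_zero.2 fun h => by subst h; exact Fin.elim0 j₀
  -- the homomorphism `φ(v) = ∑ cⱼ vⱼ` on `(ℤ/p)^d`
  let φ : (Fin d → ZMod p) →+ ZMod p :=
    { toFun := fun v => ∑ j, (ψ.coeff j : ZMod p) * v j
      map_zero' := by simp
      map_add' := fun v w => by simp only [Pi.add_apply, mul_add, sum_add_distrib] }
  have hφ : ∀ v, φ v = ∑ j, (ψ.coeff j : ZMod p) * v j := fun v => rfl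
  have hc0 : (ψ.coeff j₀ : ZMod p) ≠ 0 := by
    rwa [Ne, ZMod.intCast_zmod_eq_zero_iff_dvd]
  have hsurj : Function.Surjective φ := by
    intro a
    refine ⟨Pi.single j₀ (a / (ψ.coeff j₀ : ZMod p)), ?_⟩
    rw [hφ, sum_eq_single j₀ (fun j _ hj => by rw [Pi.single_eq_of_ne hj, mul_zero])
      (fun h => absurd (mem_univ j₀) h), Pi.single_eq_same, mul_div_assoc']
    exact mul_div_cancel_left₀ a hc0
  -- `#ker φ · p = p^d`
  have hker : Nat.card φ.ker = p ^ (d - 1) := by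
    have h1 := φ.ker.card_mul_index
    have hG : Nat.card (Fin d → ZMod p) = p ^ d := by
      rw [Nat.card_eq_fintype_card, Fintype.card_fun, ZMod.card, Fintype.card_fin]
    rw [AddSubgroup.index_ker, AddMonoidHom.range_eq_top.2 hsurj, AddSubgroup.card_top,
      Nat.card_zmod, hG] at h1
    have h2 : p ^ d = p ^ (d - 1) * p := by
      rw [← pow_succ, Nat.sub_add_cancel hd]
    rw [h2] at h1
    exact Nat.eq_of_mul_eq_mul_right hp.pos h1
  set T : Finset (Fin d → ZMod p) := {v ∈ (univ : Finset (Fin d → ZMod p)) | φ v = 0} with hT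
  have hTcard : #T = p ^ (d - 1) := by
    have e : {v // φ v = 0} ≃ φ.ker :=
      Equiv.subtypeEquivRight fun v => (AddMonoidHom.mem_ker (f := φ)).symm
    have h2 : Fintype.card {v // φ v = 0} = p ^ (d - 1) := by
      rw [← Nat.card_eq_fintype_card, Nat.card_congr e, hker]
    rw [← h2, Fintype.card_subtype]
  rw [← hTcard]
  -- the bijection `n ↦ n mod p`
  have hcast : ∀ n : Fin d → ℕ,
      ((ψ.eval fun j => (n j : ℤ) : ℤ) : ZMod p) = φ fun j => (n j : ZMod p) := by
    intro n
    rw [eval_eq_sum ψ h0, hφ]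
    push_cast
    rfl
  refine card_nbij' (fun n j => (n j : ZMod p)) (fun v j => (v j).val) (fun n hn => ?_)
    (fun v hv => ?_) (fun n hn => ?_) (fun v _ => ?_)
  · simp only [mem_coe, mem_filter, mem_univ, true_and, hT] at hn ⊢
    rw [← hcast, ZMod.intCast_zmod_eq_zero_iff_dvd]
    exact hn.2
  · simp only [mem_coe, mem_filter, mem_univ, true_and, Fintype.mem_piFinset, mem_range, hT] at hv ⊢
    refine ⟨fun j => ZMod.val_lt (v j), ?_⟩
    rw [← ZMod.intCast_zmod_eq_zero_iff_dvd, hcast]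
    simpa only [ZMod.natCast_zmod_val] using hv
  · simp only [mem_coe, mem_filter, Fintype.mem_piFinset, mem_range] at hn
    funext j
    exact ZMod.val_natCast_of_lt (hn.1 j)
  · funext j
    exact ZMod.natCast_zmod_val (v j)

/-- `β_p = 1` for a single linear form one of whose coefficients is prime to `p`:
`β_p = p^{-d} · (p/(p-1)) · #{n : p ∤ ψ(n)} = p^{-d} (p/(p-1)) (p^d - p^{d-1}) = 1`.
[cite: PandeyWoo2024, Theorem 3 (definition of `β_p`)] -/
theorem localFactor_eq_one {p : ℕ} (hp : p.Prime) (Ψ : Fin 1 → AffLinForm d)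
    (h0 : (Ψ 0).const = 0) (hj : ∃ j, ¬ (p : ℤ) ∣ (Ψ 0).coeff j) : localFactor Ψ p = 1 := by
  classical
  have hdvd := card_filter_dvd_eval hp (Ψ 0) h0 hj
  obtain ⟨j₀, hj₀⟩ := hj
  obtain ⟨m, rfl⟩ : ∃ m, d = m + 1 :=
    ⟨d - 1, (Nat.sub_add_cancel (Nat.one_le_iff_ne_zero.2 fun h => by subst h; exact Fin.elim0 j₀)).symm⟩
  have hp1 : (1 : ℝ) < p := by exact_mod_cast hp.one_lt
  set B := Fintype.piFinset (fun _ : Fin (m + 1) => range p) with hB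
  have hcardB : #B = p ^ (m + 1) := by
    rw [hB, Fintype.card_piFinset, prod_const, card_range, card_univ, Fintype.card_fin]
  rw [Nat.add_sub_cancel] at hdvd
  have hnot : (#{n ∈ B | ¬ (p : ℤ) ∣ (Ψ 0).eval fun j => (n j : ℤ)} : ℝ) = (p : ℝ) ^ m * (p - 1) := by
    have h := Finset.card_filter_add_card_filter_not (s := B)
      (p := fun n => (p : ℤ) ∣ (Ψ 0).eval fun j => (n j : ℤ))
    rw [hdvd, hcardB] at h
    have := congrArg (fun k : ℕ => (k : ℝ)) h
    push_cast at this
    linear_combination this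
  unfold localFactor
  simp only [Fin.prod_univ_one, localVonMangoldt_prime hp]
  rw [sum_ite, sum_const_zero, zero_add, sum_const, nsmul_eq_mul, ← hB, hnot]
  have hp1' : (p : ℝ) - 1 ≠ 0 := by linarith
  have hp0' : (p : ℝ) ≠ 0 := by linarith
  field_simp
  ring

/-- `β_p = 0` when `p` divides every coefficient of the single linear form (a local obstruction:
`p ∣ ψ(n)` for every `n`). [cite: PandeyWoo2024, Theorem 3 (definition of `β_p`)] -/
theorem localFactor_eq_zero {p : ℕ} (hp : p.Prime) (Ψ : Fin 1 → AffLinForm d)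
    (h0 : (Ψ 0).const = 0) (hall : ∀ j, (p : ℤ) ∣ (Ψ 0).coeff j) : localFactor Ψ p = 0 := by
  unfold localFactor
  simp only [Fin.prod_univ_one, localVonMangoldt_prime hp]
  rw [sum_eq_zero fun n _ => ?_, mul_zero]
  rw [if_pos]
  rw [eval_eq_sum _ h0]
  exact dvd_sum fun j _ => dvd_mul_of_dvd_left (hall j) _

/-- **`∏_p β_p = 1` for a primitive single form** (no prime divides all coefficients): every
partial product is `1`. [cite: PandeyWoo2024, Theorem 5 (main term for `t = 1`)] -/
theorem singularProduct_eq_one (Ψ : Fin 1 → AffLinForm d) (h0 : (Ψ 0).const = 0)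
    (hprim : ∀ p : ℕ, p.Prime → ∃ j, ¬ (p : ℤ) ∣ (Ψ 0).coeff j) : singularProduct Ψ = 1 := by
  have hpart : singularProductPartial Ψ = fun _ => 1 := by
    funext x
    unfold singularProductPartial
    exact prod_eq_one fun p hp => localFactor_eq_one (Nat.prime_of_mem_primesLE hp) Ψ h0
      (hprim p (Nat.prime_of_mem_primesLE hp))
  unfold singularProduct
  rw [hpart]
  exact tendsto_const_nhds.limUnder_eq

/-- **`∏_p β_p = 0` for an imprimitive single form**: if the prime `p` divides every coefficient,
the partial products vanish from `p` on. [cite: PandeyWoo2024, Theorem 5 (main term for `t = 1`)] -/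
theorem singularProduct_eq_zero (Ψ : Fin 1 → AffLinForm d) (h0 : (Ψ 0).const = 0) {p : ℕ}
    (hp : p.Prime) (hall : ∀ j, (p : ℤ) ∣ (Ψ 0).coeff j) : singularProduct Ψ = 0 := by
  have hev : ∀ x, p ≤ x → singularProductPartial Ψ x = 0 := by
    intro x hx
    unfold singularProductPartial
    exact prod_eq_zero (i := p) (Nat.mem_primesLE.2 ⟨hx, hp⟩) (localFactor_eq_zero hp Ψ h0 hall)
  have ht : Tendsto (singularProductPartial Ψ) atTop (𝓝 0) :=
    tendsto_const_nhds.congr' (eventually_atTop.2 ⟨p, fun x hx => (hev x hx).symm⟩)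
  exact ht.limUnder_eq

/-- **Bézout or local obstruction.** For a non-zero integer vector `c ∈ ℤ^d`: either
`∑ⱼ cⱼ vⱼ = 1` for some `v ∈ ℤ^d`, or some prime divides every `cⱼ` (the ideal `(c₁, …, c_d)`
of the principal ideal ring `ℤ` is `(g)`, and `g` is a unit or has a prime factor). [folklore] -/
theorem bezout_or_prime_dvd (c : Fin d → ℤ) (hc : c ≠ 0) :
    (∃ v : Fin d → ℤ, ∑ j, c j * v j = 1) ∨ ∃ p : ℕ, p.Prime ∧ ∀ j, (p : ℤ) ∣ c j := by
  classical
  set I : Ideal ℤ := Ideal.span (Set.range c) with hI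
  set g : ℤ := Submodule.IsPrincipal.generator I with hg
  have hIg : Ideal.span {g} = I := Ideal.span_singleton_generator I
  have hmem : ∀ j, c j ∈ I := fun j => Ideal.subset_span ⟨j, rfl⟩
  by_cases hu : IsUnit g
  · left
    have h1 : (1 : ℤ) ∈ I := by
      rw [← hIg]
      exact Ideal.mem_span_singleton.2 hu.dvd
    obtain ⟨v, hv⟩ := Ideal.mem_span_range_iff_exists_fun.1 h1
    exact ⟨v, by simpa only [mul_comm] using hv⟩
  · right
    have hg0 : g ≠ 0 := by
      intro hg0
      apply hc
      have hbot : I = ⊥ := (Submodule.IsPrincipal.eq_bot_iff_generator_eq_zero I).2 hg0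
      funext j
      have := hmem j
      rw [hbot, Ideal.mem_bot] at this
      exact this
    have hg1 : g.natAbs ≠ 1 := fun h => hu (Int.isUnit_iff_natAbs_eq.2 h)
    refine ⟨g.natAbs.minFac, Nat.minFac_prime hg1, fun j => ?_⟩
    have hcj : g ∣ c j := by
      have := hmem j
      rw [← hIg] at this
      exact Ideal.mem_span_singleton.1 this
    exact (Int.natCast_dvd.2 (Nat.minFac_dvd g.natAbs)).trans hcj

/-! ## Boxes: translation to `[0, H]^d` -/

/-- The lattice points of `∏ⱼ [zⱼ, zⱼ + H]` are the translates `z + u`, `u ∈ {0, …, H}^d`: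
counting points with a property `Q` in the box is counting `u` with `Q(z + u)`. [folklore] -/
theorem card_box_filter_eq (z : Fin d → ℤ) (Hn : ℕ) (Q : (Fin d → ℤ) → Prop) [DecidablePred Q] :
    #{n ∈ Fintype.piFinset (fun j => Icc (z j) (z j + Hn)) | Q n} =
      #{u ∈ Fintype.piFinset (fun _ : Fin d => range (Hn + 1)) | Q (z + fun j => (u j : ℤ))} := by
  symm
  refine card_nbij' (fun u => z + fun j => (u j : ℤ)) (fun n j => (n j - z j).toNat)
    (fun u hu => ?_) (fun n hn => ?_) (fun u _ => ?_) (fun n hn => ?_)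
  · simp only [mem_coe, mem_filter, Fintype.mem_piFinset, mem_range] at hu ⊢
    refine ⟨fun j => mem_Icc.2 ⟨?_, ?_⟩, hu.2⟩
    · simp
    · have := hu.1 j
      simp only [Pi.add_apply]
      omega
  · simp only [mem_coe, mem_filter, Fintype.mem_piFinset, mem_Icc, mem_range] at hn ⊢
    refine ⟨fun j => ?_, ?_⟩
    · have := hn.1 j; omega
    · convert hn.2 using 2
      funext j
      have := hn.1 j
      simp only [Pi.add_apply]
      omega
  · funext j
    simp
  · simp only [mem_coe, mem_filter, Fintype.mem_piFinset, mem_Icc] at hn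
    funext j
    have := hn.1 j
    simp only [Pi.add_apply]
    omega

/-- For a single form, `primePatternCount` tests primality of `ψ₀(n)` only. [folklore] -/
theorem primePatternCount_fin_one (Ψ : Fin 1 → AffLinForm d) (x : Fin d → ℕ) (H : ℝ) :
    primePatternCount Ψ x H = #{n ∈ shortBox x H | ((Ψ 0).eval n).toNat.Prime} := by
  unfold primePatternCount
  congr 1
  exact filter_congr fun n _ => by simp [Fin.forall_fin_one]

/-- The prime-pattern count of a single form over `∏ⱼ [zⱼ, zⱼ + H]` for an integer corner `z ≥ 0`,
as a count over `u ∈ {0, …, ⌊H⌋}^d` of the `u` with `ψ(z + u)` prime. [folklore] -/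
theorem primePatternCount_eq_card (Ψ : Fin 1 → AffLinForm d) {z : Fin d → ℤ} (hz : ∀ j, 0 ≤ z j)
    (H : ℝ) :
    primePatternCount Ψ (fun j => (z j).toNat) H =
      #{u ∈ Fintype.piFinset (fun _ : Fin d => range (⌊H⌋₊ + 1)) |
        ((Ψ 0).eval (z + fun j => (u j : ℤ))).toNat.Prime} := by
  classical
  rw [primePatternCount_fin_one]
  unfold shortBox
  rw [← card_box_filter_eq z ⌊H⌋₊ (fun n => ((Ψ 0).eval n).toNat.Prime)]
  simp only [Int.toNat_of_nonneg (hz _)]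

end SingleForm

end Literature.Barriers.Parity
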